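import Summits.Ventures.DiscreteObjects.PP12.FanoFiveIncMatrix

/-!
# PP(12), order 5: the orbit-matrix statements are invariant under relabelling the fixed Fano subplane — 'one labelling suffices' modulo Fano uniqueness (kernel)
Framing: lottery ticket; floor = certified bounds/negative ranges.

Cell pub-namedobj (venture DiscreteObjects), target (M), designs gen 16 (designs g15 HANDOFF item (f), first half). `NoFanoFiveIncMatrix`
(`FanoFiveIncMatrix`, designs g15) quantifies over ALL labelled Fano incidences `I : Fin 7 → Fin 7 → Bool`, while an engine (designs g10) fixes ONE
labelling `I₀`. Here: relabelling the fixed points by `π` and the fixed lines by `ρ` (`FanoFive.reidx`, acting on the tangent indices of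
`F5Idx = (Fin 7 × Fin 2) ⊕ Fin 16`) transports orbit matrices — `isFanoFiveOrbitMatrix_relabel`, `isFanoFiveIncMatrix_relabel` (the plain system's
`total`/`target` only see the index kind and equalities; the four incidence blocks follow the labels) — hence
**`noFanoFiveIncMatrix_of_one_labelling`**: if NO matrix exists for one labelling `I₀` and every labelled Fano incidence is isomorphic to `I₀`
(uniqueness of the projective plane of order 2 up to isomorphism — classical; NOT proved here, taken as the hypothesis `hU`), then `NoFanoFiveIncMatrix`.
What remains for the p = 5 identification (HANDOFF): (i) `hU` in the kernel; (ii) designs g10's engine system (signs/Gram form) derived from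
`IsFanoFiveIncMatrix I₀`. Nothing here asserts any census statement. No `sorry`, no new axioms.
-/

namespace Summit.Ventures.DiscreteObjects.PP12

open Finset

namespace FanoFive

/-- relabelling of the tangent indices by a permutation of `Fin 7` (exterior indices unchanged) -/
def reidx (π : Equiv.Perm (Fin 7)) : F5Idx ≃ F5Idx := Equiv.sumCongr (Equiv.prodCongr π (Equiv.refl (Fin 2))) (Equiv.refl (Fin 16))

/-- `reidx` on a tangent index -/
@[simp] theorem reidx_inl (π : Equiv.Perm (Fin 7)) (x : Fin 7) (a : Fin 2) : reidx π (Sum.inl (x, a)) = Sum.inl (π x, a) := rfl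
/-- `reidx` on an exterior index -/
@[simp] theorem reidx_inr (π : Equiv.Perm (Fin 7)) (e : Fin 16) : reidx π (Sum.inr e) = Sum.inr e := rfl
/-- inverse of `reidx` on a tangent index -/
@[simp] theorem reidx_symm_inl (π : Equiv.Perm (Fin 7)) (x : Fin 7) (a : Fin 2) : (reidx π).symm (Sum.inl (x, a)) = Sum.inl (π.symm x, a) := rfl
/-- inverse of `reidx` on an exterior index -/
@[simp] theorem reidx_symm_inr (π : Equiv.Perm (Fin 7)) (e : Fin 16) : (reidx π).symm (Sum.inr e) = Sum.inr e := rfl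

/-- totals are invariant -/
theorem total_reidx_symm (π : Equiv.Perm (Fin 7)) (r : F5Idx) : total ((reidx π).symm r) = total r := by
  rcases r with ⟨x, a⟩ | e <;> rfl

/-- targets are invariant -/
theorem target_reidx_symm (π : Equiv.Perm (Fin 7)) (r r' : F5Idx) : target ((reidx π).symm r) ((reidx π).symm r') = target r r' := by
  rcases r with ⟨x, a⟩ | e <;> rcases r' with ⟨y, b⟩ | e' <;> simp [target, π.symm.injective.eq_iff]

end FanoFive

/-- **the relabelled matrix**: rows relabelled by `π` (fixed points), columns by `ρ` (fixed lines) -/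
def relabelM (π ρ : Equiv.Perm (Fin 7)) (M : F5Idx → F5Idx → ℕ) : F5Idx → F5Idx → ℕ :=
  fun r c => M ((FanoFive.reidx π).symm r) ((FanoFive.reidx ρ).symm c)

/-- **the plain system is invariant under relabelling** -/
theorem isFanoFiveOrbitMatrix_relabel {M : F5Idx → F5Idx → ℕ} (h : IsFanoFiveOrbitMatrix M) (π ρ : Equiv.Perm (Fin 7)) :
    IsFanoFiveOrbitMatrix (relabelM π ρ M) := by
  obtain ⟨h1, h2, h3, h4⟩ := h
  refine ⟨fun r => ?_, fun c => ?_, fun r r' => ?_, fun c c' => ?_⟩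
  · simp only [relabelM]
    rw [Equiv.sum_comp (FanoFive.reidx ρ).symm (fun c => M ((FanoFive.reidx π).symm r) c), h1, FanoFive.total_reidx_symm]
  · simp only [relabelM]
    rw [Equiv.sum_comp (FanoFive.reidx π).symm (fun r => M r ((FanoFive.reidx ρ).symm c)), h2, FanoFive.total_reidx_symm]
  · simp only [relabelM]
    rw [Equiv.sum_comp (FanoFive.reidx ρ).symm (fun c => M ((FanoFive.reidx π).symm r) c * M ((FanoFive.reidx π).symm r') c), h3,
      FanoFive.target_reidx_symm]
  · simp only [relabelM]
    rw [Equiv.sum_comp (FanoFive.reidx π).symm (fun r => M r ((FanoFive.reidx ρ).symm c) * M r ((FanoFive.reidx ρ).symm c')), h4,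
      FanoFive.target_reidx_symm]

/-- **the system with incidence is transported along the relabelled incidence** `I' x μ = I (π⁻¹ x) (ρ⁻¹ μ)` -/
theorem isFanoFiveIncMatrix_relabel {I : Fin 7 → Fin 7 → Bool} {M : F5Idx → F5Idx → ℕ} (h : IsFanoFiveIncMatrix I M)
    (π ρ : Equiv.Perm (Fin 7)) : IsFanoFiveIncMatrix (fun x μ => I (π.symm x) (ρ.symm μ)) (relabelM π ρ M) := by
  obtain ⟨h0, h1, h2, h3, h4⟩ := h
  refine ⟨isFanoFiveOrbitMatrix_relabel h0 π ρ, fun x a μ => ?_, fun e μ => ?_, fun μ b x => ?_, fun e x => ?_⟩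
  · simpa [relabelM] using h1 (π.symm x) a (ρ.symm μ)
  · simpa [relabelM] using h2 e (ρ.symm μ)
  · simpa [relabelM] using h3 (ρ.symm μ) b (π.symm x)
  · simpa [relabelM] using h4 e (π.symm x)

/-- **'One labelling suffices', modulo Fano uniqueness.** If no orbit matrix exists for ONE labelled Fano incidence `I₀`, and every labelled Fano
incidence is isomorphic to `I₀` (hypothesis `hU`: uniqueness of the plane of order 2 up to relabelling points and lines — classical, not proved
here), then `NoFanoFiveIncMatrix`. -/
theorem noFanoFiveIncMatrix_of_one_labelling (I₀ : Fin 7 → Fin 7 → Bool) (h0 : ∀ M : F5Idx → F5Idx → ℕ, ¬ IsFanoFiveIncMatrix I₀ M)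
    (hU : ∀ I : Fin 7 → Fin 7 → Bool, FanoFive.IsIncidence I → ∃ π ρ : Equiv.Perm (Fin 7), ∀ x μ, I x μ = I₀ (π x) (ρ μ)) :
    NoFanoFiveIncMatrix := by
  intro I M hI hM
  obtain ⟨π, ρ, hiso⟩ := hU I hI
  have h := isFanoFiveIncMatrix_relabel hM π ρ
  have e : (fun x μ => I (π.symm x) (ρ.symm μ)) = I₀ := by
    funext x μ
    rw [hiso, Equiv.apply_symm_apply, Equiv.apply_symm_apply]
  rw [e] at h
  exact h0 _ h

/-- Conversely (trivially) `NoFanoFiveIncMatrix` gives the one-labelling statement. -/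
theorem one_labelling_of_noFanoFiveIncMatrix (h : NoFanoFiveIncMatrix) (I₀ : Fin 7 → Fin 7 → Bool) (hI₀ : FanoFive.IsIncidence I₀)
    (M : F5Idx → F5Idx → ℕ) : ¬ IsFanoFiveIncMatrix I₀ M :=
  h I₀ M hI₀

end Summit.Ventures.DiscreteObjects.PP12
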